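/- Copyright: the b2b-balaban cell (near-miss cell 7), T⁴-continuum CRUX team (coordinator ruling e34b3e0c item (2)),
seat t4-ne7b-formalise-leaf-01 (gen 29). Released under the licence of the surrounding project. -/
import Literature.MathematicalPhysics.QuantumFieldTheory.Balaban1983to89.B16Ineq382TreeGauge
import Literature.MathematicalPhysics.QuantumFieldTheory.Balaban1983to89.UnitaryModel
import Summits.QuantumFields.BalabanUV.T4Continuum.Spine.NE7b.NonAbelianStokesReading

/-!
# (TC-box) in HOLONOMY FORM and the thick-collar gauge (1′): a box collar carries no forced flux
# (route NE7b R-H ∕ C-RH°, `t4/ROUTES-NE7b.md` v7 §1 (TC), (TC-box), answer (1′); v8 item 1 «geometry records under bill A»; v9 L-v9-1)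

Cell `pub-balaban`, sub-cell `t4`, spine estimate NE7b (node U5c), candidate route R-H «Peierls healing map». ROUTES-NE7b v7 §1
classifies the loops of the collar `coll(x)` of a healing domain `H(x)`: Type I (null-homotopic in the collar: holonomy controlled by the
collar amplitude `a(e)` through (NAS)), Type II (null-homotopic only THROUGH `H`: holonomy an `a(e)`-independent datum of the exterior,
which by (FF) forces interior curvature in every filling — leaf-05's witness W-hol `HollowForcedFluxWitness` for a HOLLOW `H`), Type III
(torus cycles). (TC-box): for `H` a rectangular parallelepiped — print's convention (BOX), B15 (1.73) — Type II is EMPTY (Seifert–van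
Kampen). The kernel has no `π₁`; as in W-hol, THE HOLONOMY IS THE CERTIFICATE. This file proves the holonomy-level form of (TC-box) + (1′):
* §1 **SMALL BONDS IN SOME GAUGE ⇒ SMALL LOOPS** (any `d`; `U1 𝔸` carrier of `B7Prop1Explicit` = units of norm `≤ 1` of a normed ring —
  `U(N)`, unit quaternions — and the `GaugeGroup.dist1` carrier of (NAS)∕(FF)): if some gauge function makes every bond with both ends in
  a site set `A` `δ`-small, EVERY CLOSED lattice walk `w` in `A` (`PathIn A p w`, `disp w = 0`) has `‖V(w) − 1‖ ≤ |w|·δ`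
  (`norm_hol_closed_sub_one_le_of_gauge`, `dist1_hol_closed_le_of_gauge`): no loop in `A` carries an amplitude-independent holonomy.
* §2 **THE BOX COLLAR** `ann lo hi lo' hi' = P₁ ∖ P₂ ⊂ ℤ^{n+3}` (`B15TreeGauge196Annulus.ann`; `P₂ = box lo' hi'` non-empty, strictly
  inside `P₁ = box lo hi`, sides of `P₁` of at most `W + 1` sites; `d = n + 3 ≥ 3` — in `d = 2` the collar is a cycle and the claim is
  false). (1′) **`exists_gauge_bonds_le`**: `‖V(∂p) − 1‖ ≤ ε` on the plaquettes with four corners in the collar (`B16Ineq382.PlaqSmallOn`)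
  ⇒ some `U1`-valued gauge makes EVERY collar bond `≤ (5W² + dW)·ε` — the tree's cited reproduction `B16Ineq382.case1Hyp_gaugeFixed` +
  `norm_bond_sub_one_le` ([Balaban1989LargeFieldII] pp.381–382 case 1 over the p.196 tree gauge of [Balaban1989LargeFieldI] on `P₁ ∖ P₂`)
  READ at the threshold `τ := lo′₁`, nothing re-proved; ROUTES v7's «sup_b |U_b − 1| ≤ c_fill·diam(coll)²·a(e)», `c_fill·diam² ≤ 6W²`.
  (TC-box) **`norm_hol_closed_sub_one_le`**: every closed collar walk has `‖V(w) − 1‖ ≤ |w|·(5W² + dW)·ε` (`…_le'`: `|w|·6W²·ε` for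
  `W ≥ d`); the rectangular Wilson loop **`norm_hol_rectWord_sub_one_le`** over leaf-01 g28's `NonAbelianStokesBound.rectWord` (`2(R+T)`
  bonds; only the loop's SITES need lie in the collar — the spanned rectangle may cross `P₂`, i.e. (FF)'s `D ∩ H ≠ ∅`): under (BOX) the
  numerator `|h − 1|` of (FF)'s floor `(|h − 1| − #(D∩coll)·a) ∕ #(D∩H)` (`NonAbelianStokesReading.forcedFlux_rectangle`) is itself `O(a)` —
  the joint near-flat filling obstruction of W-hol is specific to hollow healing domains.
* §3 **CARRIERS** of the `Spine/NE7b` files by transfer along a hom `ι : G →* 𝔸ˣ` into `U1 𝔸` with `‖ι g − 1‖ = s g` (`hol_map`,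
  `size_hol_closed_le_of_hom`): `S³ = Metric.sphere (0 : ℍ) 1` (`unitSphereToUnits ℍ`; `‖q − 1‖` = `sphereGaugeGroup.dist1 q`) for
  `ZdGaugeConfig (n+3) S³` — **`sphere_norm_hol_closed_sub_one_le`**, **`sphere_norm_rectangle_sub_one_le`**; `SU(N)` with the tree's
  instance `UnitaryModel.instGaugeGroupSpecialUnitaryGroup` (`dist1 = ‖· − 1‖_{op}`) — **`su_dist1_hol_closed_le`**, **`su_dist1_rectangle_le`**.

HONEST FRAMING. Law-free lattice algebra about ONE configuration plus a READING of a cited tree reproduction (B16 p.382, lit-balaban p26)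
on the route's carriers; no measure, no effective action, no constant of [Bałaban 1983–89] asserted by this file; nothing of bill A's
clause, (JC), (S-E), (MP<L²), H1–H3, (HULL), (TWIST). The ℤ^d collar models the UNWRAPPED case of (TC-box) (PRICING F38 (c): `∂⁺H ≅ S³`);
wrapped parallelepipeds (prefix regime) and the statement `π₁(coll) ≅ π₁(H ∪ coll)` itself are NOT treated. NE7b (`T4WeightBudget.RelWeightBound`)
NOT PRINTED, NOT PROVED; spine PROVED 0∕9; rung (B)+1 on a FINITE torus T⁴ — NOT infinite volume, NOT the mass gap, NOT Clay. HONEST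
DEPENDENCY: continuum YM on T⁴ ⇐ BetaPertH ∧ nine spine estimates (0/9 proved); BetaPertH ⇐ (D1) ∧ (D4) ∧ CAP+tail; G-an2-4 gates asym,
D1 and NE2/3/4. STATUS AT FILING: PRICING-NE7b v10 grades C-RH° KILL-CANDIDATE — this file claims NO route value; it is SUPPLIER-GRADE
lattice anatomy (B16 p.382's annulus tree gauge on the `Spine/NE7b` carriers; the positive counterpart of W-hol) and records that (1′) in
COLLAR-LOCAL form IS in the tree (`B16Ineq382`, hypothesis `PlaqSmallOn (ann …)`), not a gap. POLICY: crux-route work under `Spine/NE7b/`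
(ROUTES v7 §6 ∕ v8.1 item 7's offered items; FREEZE (0) respected: not a `T4Continuum/Support` leaf); no definition, no `Prop` fact, no `[cite:]`.
-/

set_option autoImplicit false

namespace Summit.QuantumFields.BalabanUV.T4Continuum.NE7b.BoxCollarHolonomy

noncomputable section

open Literature.MathematicalPhysics.QuantumFieldTheory.Balaban1983to89 (GaugeGroup dist1)
open Literature.MathematicalPhysics.QuantumFieldTheory.Balaban1983to89.B7Prop1Explicit
  (Letter e stepHol stepHol_true stepHol_false hol hol_nil hol_cons hol_append disp disp_nil disp_cons disp_append seg disp_seg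
    length_seg plaqWord revWord revWord_seg length_revWord disp_revWord gaugeAct hol_gaugeAct_closed U1 mem_U1 norm_inv_sub_one_le
    norm_units_inv_conj_sub_one_le stepHol_mem hol_mem gaugeAct_mem)
open Literature.MathematicalPhysics.QuantumFieldTheory.Balaban1983to89.B8Ineq170 (norm_mul_sub_one_le_of_norm_le_one)
open Literature.MathematicalPhysics.QuantumFieldTheory.Balaban1983to89.B15TreeGauge196 (PathIn pathIn_cons pathIn_append pathIn_seg_natCast pathIn_seg_neg ann Geom i0 treeGaugeFn)
open Literature.MathematicalPhysics.QuantumFieldTheory.Balaban1983to89.B16Ineq382 (PlaqSmallOn case1Hyp_gaugeFixed norm_bond_sub_one_le)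
open Literature.MathematicalPhysics.QuantumFieldTheory (ZdGaugeConfig)
open Summit.QuantumFields.BalabanUV.T4Continuum.NE7b.NonAbelianStokesBound (rectWord disp_rectWord)
open Summit.QuantumFields.BalabanUV.T4Continuum.NE7b.NonAbelianStokesReading (curry natCast_smul_e plaquette_eq_hol_plaqWord rectangle_eq_hol_rectWord)

/-! ## §1 Small bonds in some gauge ⇒ small loops (the no-forced-flux principle) -/

section NormedUnits

variable {d : ℕ} {𝔸 : Type*} [NormedRing 𝔸] [NormOneClass 𝔸]

/-- **BONDS SMALL ON `A` ⇒ WALKS IN `A` SMALL** (`U1` carrier): if every bond `⟨x, x + e_μ⟩` with both ends in the site set `A` has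
`‖V(b) − 1‖ ≤ δ`, every lattice walk `w` from `p` with vertices in `A` has `‖V(w) − 1‖ ≤ |w|·δ` (telescoping `‖ab − 1‖ ≤ ‖a − 1‖ + ‖b − 1‖`
for `‖a‖ ≤ 1`; a backward letter reads the bond `⟨x − e_μ, x⟩` through `‖u⁻¹ − 1‖ ≤ ‖u − 1‖`). -/
theorem norm_hol_sub_one_le_of_bonds {V : (Fin d → ℤ) → Fin d → 𝔸ˣ} (hV : ∀ x κ, V x κ ∈ U1 𝔸) {A : Set (Fin d → ℤ)}
    {δ : ℝ} (hA : ∀ (x : Fin d → ℤ) (μ : Fin d), x ∈ A → x + e μ ∈ A → ‖((V x μ : 𝔸ˣ) : 𝔸) - 1‖ ≤ δ) :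
    ∀ (w : List (Letter d)) (p : Fin d → ℤ), PathIn A p w → ‖((hol V p w : 𝔸ˣ) : 𝔸) - 1‖ ≤ w.length * δ
  | [], p, _ => by simp
  | l :: w, p, hw => by
    obtain ⟨hp, hw'⟩ := pathIn_cons.mp hw
    have hq : p + l.vec ∈ A := hw'.start
    rw [hol_cons, Units.val_mul, List.length_cons, Nat.cast_succ, add_mul, one_mul, add_comm (_ * δ)]
    refine (norm_mul_sub_one_le_of_norm_le_one (mem_U1.mp (stepHol_mem hV p l)).1).trans
      (add_le_add ?_ (norm_hol_sub_one_le_of_bonds hV hA w (p + l.vec) hw'))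
    obtain ⟨μ, b⟩ := l
    cases b
    · -- backward letter: `V(p − e_μ, p)⁻¹`, the bond `⟨p − e_μ, p⟩` has both ends in `A`
      have hq' : p - e μ ∈ A := by simpa [sub_eq_add_neg] using hq
      rw [stepHol_false]
      exact (norm_inv_sub_one_le (hV _ _)).trans (hA _ μ hq' (by rwa [sub_add_cancel]))
    · rw [stepHol_true]
      exact hA p μ hp (by simpa using hq)

/-- **SMALL BONDS IN SOME GAUGE ⇒ SMALL LOOPS** (`U1` carrier): if a `U1`-valued gauge function `g` makes every bond with both ends
in `A` `δ`-small, `‖V^g(b) − 1‖ ≤ δ`, every CLOSED walk `w` from `p` staying in `A` has `‖V(w) − 1‖ ≤ |w|·δ` (a closed walk's holonomy is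
conjugate to its holonomy in any gauge): no loop in `A` carries a `δ`-independent holonomy — `A` has no forced flux. -/
theorem norm_hol_closed_sub_one_le_of_gauge {V : (Fin d → ℤ) → Fin d → 𝔸ˣ} (hV : ∀ x κ, V x κ ∈ U1 𝔸)
    {g : (Fin d → ℤ) → 𝔸ˣ} (hg : ∀ x, g x ∈ U1 𝔸) {A : Set (Fin d → ℤ)} {δ : ℝ}
    (hA : ∀ (x : Fin d → ℤ) (μ : Fin d), x ∈ A → x + e μ ∈ A → ‖((gaugeAct g V x μ : 𝔸ˣ) : 𝔸) - 1‖ ≤ δ)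
    {p : Fin d → ℤ} {w : List (Letter d)} (hw : PathIn A p w) (hcl : disp w = 0) :
    ‖((hol V p w : 𝔸ˣ) : 𝔸) - 1‖ ≤ w.length * δ := by
  have hid : hol V p w = (g p)⁻¹ * hol (gaugeAct g V) p w * g p := by
    rw [hol_gaugeAct_closed g V p w hcl]; group
  rw [hid, Units.val_mul, Units.val_mul]
  exact (norm_units_inv_conj_sub_one_le (hg p) _).trans (norm_hol_sub_one_le_of_bonds (gaugeAct_mem hV hg) hA w p hw)

end NormedUnits

section GaugeGroupCarrier

variable {d : ℕ} {G : Type*} [GaugeGroup G]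

/-- **BONDS SMALL ON `A` ⇒ WALKS IN `A` SMALL** (`GaugeGroup.dist1` carrier, the one of (NAS)∕(FF)): if every bond with both ends in
`A` has `dist1 V(b) ≤ δ` then every walk in `A` has `dist1 V(w) ≤ |w|·δ`. -/
theorem dist1_hol_le_of_bonds {V : (Fin d → ℤ) → Fin d → G} {A : Set (Fin d → ℤ)} {δ : ℝ}
    (hA : ∀ (x : Fin d → ℤ) (μ : Fin d), x ∈ A → x + e μ ∈ A → dist1 (V x μ) ≤ δ) :
    ∀ (w : List (Letter d)) (p : Fin d → ℤ), PathIn A p w → dist1 (hol V p w) ≤ w.length * δ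
  | [], p, _ => by simp [GaugeGroup.dist1_one]
  | l :: w, p, hw => by
    obtain ⟨hp, hw'⟩ := pathIn_cons.mp hw
    have hq : p + l.vec ∈ A := hw'.start
    rw [hol_cons, List.length_cons, Nat.cast_succ, add_mul, one_mul, add_comm (_ * δ)]
    refine (GaugeGroup.dist1_mul_le _ _).trans (add_le_add ?_ (dist1_hol_le_of_bonds hA w (p + l.vec) hw'))
    obtain ⟨μ, b⟩ := l
    cases b
    · have hq' : p - e μ ∈ A := by simpa [sub_eq_add_neg] using hq
      rw [stepHol_false, GaugeGroup.dist1_inv]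
      exact hA _ μ hq' (by rwa [sub_add_cancel])
    · rw [stepHol_true]
      exact hA p μ hp (by simpa using hq)

/-- **SMALL BONDS IN SOME GAUGE ⇒ SMALL LOOPS** (`GaugeGroup.dist1` carrier): if a gauge function `g` makes every bond with both ends
in `A` satisfy `dist1 V^g(b) ≤ δ`, every closed walk in `A` has `dist1 V(w) ≤ |w|·δ` (`dist1` is conjugation invariant). -/
theorem dist1_hol_closed_le_of_gauge {V : (Fin d → ℤ) → Fin d → G} (g : (Fin d → ℤ) → G) {A : Set (Fin d → ℤ)} {δ : ℝ}
    (hA : ∀ (x : Fin d → ℤ) (μ : Fin d), x ∈ A → x + e μ ∈ A → dist1 (gaugeAct g V x μ) ≤ δ)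
    {p : Fin d → ℤ} {w : List (Letter d)} (hw : PathIn A p w) (hcl : disp w = 0) :
    dist1 (hol V p w) ≤ w.length * δ := by
  have hid : hol V p w = (g p)⁻¹ * hol (gaugeAct g V) p w * ((g p)⁻¹)⁻¹ := by
    rw [hol_gaugeAct_closed g V p w hcl]; group
  rw [hid, GaugeGroup.dist1_conj]
  exact dist1_hol_le_of_bonds hA w p hw

end GaugeGroupCarrier

/-! ## §2 The box collar `P₁ ∖ P₂ ⊂ ℤ^{n+3}`: the tree gauge (1′) and (TC-box) in holonomy form -/

section Words

variable {d : ℕ}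

/-- The rectangular Wilson loop `rectWord κ μ R T` (`R` steps `+e_κ`, `T` `+e_μ`, `R` `−e_κ`, `T` `−e_μ`) has `2(R + T)` bonds. -/
theorem length_rectWord (κ μ : Fin d) (R T : ℕ) : (rectWord κ μ R T : List (Letter d)).length = 2 * (R + T) := by
  simp only [rectWord, List.length_append, length_revWord, length_seg, Int.natAbs_natCast]
  ring

/-- **A RECTANGULAR LOOP IS A WALK IN `S` WHEN ITS BOUNDARY SITES ARE**: if the sites of the four sides of the `R × T` rectangle based
at `x` in the `(κ, μ)`-plane lie in `S`, the boundary word is a walk in `S` (the spanned plaquettes may leave `S`). -/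
theorem pathIn_rectWord {S : Set (Fin d → ℤ)} {x : Fin d → ℤ} {κ μ : Fin d} {R T : ℕ}
    (h₁ : ∀ s : ℕ, s ≤ R → x + (s : ℤ) • e κ ∈ S)
    (h₂ : ∀ t : ℕ, t ≤ T → x + (R : ℤ) • e κ + (t : ℤ) • e μ ∈ S)
    (h₃ : ∀ s : ℕ, s ≤ R → x + (s : ℤ) • e κ + (T : ℤ) • e μ ∈ S)
    (h₄ : ∀ t : ℕ, t ≤ T → x + (t : ℤ) • e μ ∈ S) :
    PathIn S x (rectWord κ μ R T) := by
  rw [rectWord, pathIn_append, pathIn_append, pathIn_append]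
  refine ⟨⟨⟨pathIn_seg_natCast.mpr h₁, ?_⟩, ?_⟩, ?_⟩
  · rw [disp_seg]
    exact pathIn_seg_natCast.mpr h₂
  · rw [disp_append, disp_seg, disp_seg, revWord_seg, pathIn_seg_neg]
    intro j hj
    have := h₃ (R - j) (Nat.sub_le R j)
    rw [Nat.cast_sub hj, sub_smul] at this
    convert this using 1
    abel
  · rw [disp_append, disp_append, disp_seg, disp_seg, disp_revWord, disp_seg, revWord_seg, pathIn_seg_neg]
    intro j hj
    have := h₄ (T - j) (Nat.sub_le T j)
    rw [Nat.cast_sub hj, sub_smul] at this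
    convert this using 1
    abel

end Words

section BoxCollar

variable {n : ℕ} {𝔸 : Type*} [NormedRing 𝔸] [NormOneClass 𝔸]
variable {lo hi lo' hi' : Fin (n + 3) → ℤ} {W : ℕ} {V : (Fin (n + 3) → ℤ) → Fin (n + 3) → 𝔸ˣ} {ε : ℝ}

/-- THE COLLAR GEOMETRY as `B15TreeGauge196.Geom` with threshold `τ := lo′₁`: `P₂ = box lo' hi' ≠ ∅` strictly inside `P₁ = box lo hi`. -/
theorem geom_collar (hlo : ∀ κ, lo κ < lo' κ) (hhi : ∀ κ, hi' κ < hi κ) (hP₂ : lo' ≤ hi') :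
    Geom lo hi lo' hi' (lo' i0) :=
  ⟨hlo, hhi, by omega, hP₂ i0⟩

/-- The constant simplified: `5W² + dW ≤ 6W²` once `W ≥ d` (cf. the printed `6(100MR)²` of B16 p.382). -/
theorem quadratic_le_six_sq (hd : n + 3 ≤ W) : (5 * (W : ℝ) ^ 2 + (n + 3) * W) ≤ 6 * (W : ℝ) ^ 2 := by
  have hd' : (n : ℝ) + 3 ≤ W := by exact_mod_cast hd
  have hW : (0 : ℝ) ≤ W := Nat.cast_nonneg W
  nlinarith

/-! Standing hypotheses of the rest of §2: `P₂ ≠ ∅` strictly inside `P₁`, sides of `P₁` of `≤ W + 1` sites, `V` `U1`-valued,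
every plaquette with its four corners in the collar `ε`-small. -/
variable (hlo : ∀ κ, lo κ < lo' κ) (hhi : ∀ κ, hi' κ < hi κ) (hP₂ : lo' ≤ hi') (hW : ∀ κ, hi κ - lo κ ≤ W)
  (hV : ∀ x κ, V x κ ∈ U1 𝔸) (hε : 0 ≤ ε) (hP : PlaqSmallOn (ann lo hi lo' hi') V ε)
include hlo hhi hP₂ hW hV hε hP

/-- **(1′) THE THICK-COLLAR TREE GAUGE** (ROUTES-NE7b v7 answer (1′) «e⌈coll is gauge-equivalent to a configuration with
`sup_b |U_b − 1| ≤ c_fill·diam(coll)²·a(e)`»): on the collar `P₁ ∖ P₂ ⊂ ℤ^{n+3}` some `U1`-valued gauge function (the tree's p.196 tree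
gauge `treeGaugeFn V lo hi lo′₁`) makes EVERY bond with both ends in the collar satisfy `‖V^g(b) − 1‖ ≤ (5W² + dW)·ε` —
`B16Ineq382.case1Hyp_gaugeFixed` + `norm_bond_sub_one_le` BY NAME (B16 p.382 case 1, lit-balaban's reproduction); nothing re-proved. -/
theorem exists_gauge_bonds_le :
    ∃ g : (Fin (n + 3) → ℤ) → 𝔸ˣ, (∀ x, g x ∈ U1 𝔸) ∧
      ∀ (x : Fin (n + 3) → ℤ) (μ : Fin (n + 3)), x ∈ ann lo hi lo' hi' → x + e μ ∈ ann lo hi lo' hi' →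
        ‖((gaugeAct g V x μ : 𝔸ˣ) : 𝔸) - 1‖ ≤ (5 * (W : ℝ) ^ 2 + (n + 3) * W) * ε :=
  ⟨treeGaugeFn V lo hi (lo' i0), fun _ => hol_mem hV _ _, fun _ _ hx hx' =>
    norm_bond_sub_one_le (case1Hyp_gaugeFixed (geom_collar hlo hhi hP₂) hW hV hε hP) hx hx'⟩

/-- **(TC-box), HOLONOMY FORM — A BOX COLLAR CARRIES NO TYPE-II HOLONOMY**: on the collar `P₁ ∖ P₂ ⊂ ℤ^{n+3}` (hypotheses above),
EVERY CLOSED lattice walk `w` whose vertices stay in the collar has `‖V(w) − 1‖ ≤ |w|·(5W² + dW)·ε`: every collar loop is controlled by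
the collar plaquettes (contrast: for a hollow `H` the collar can be flat and yet carry an arbitrary holonomy — leaf-05's W-hol). -/
theorem norm_hol_closed_sub_one_le {p : Fin (n + 3) → ℤ} {w : List (Letter (n + 3))} (hw : PathIn (ann lo hi lo' hi') p w)
    (hcl : disp w = 0) : ‖((hol V p w : 𝔸ˣ) : 𝔸) - 1‖ ≤ w.length * ((5 * (W : ℝ) ^ 2 + (n + 3) * W) * ε) := by
  obtain ⟨g, hg, hA⟩ := exists_gauge_bonds_le hlo hhi hP₂ hW hV hε hP
  exact norm_hol_closed_sub_one_le_of_gauge hV hg hA hw hcl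

/-- **(TC-box), HOLONOMY FORM, constant `6W²`** (for `W ≥ d`): every closed walk in the collar has `‖V(w) − 1‖ ≤ |w|·6W²·ε`. -/
theorem norm_hol_closed_sub_one_le' (hd : n + 3 ≤ W) {p : Fin (n + 3) → ℤ} {w : List (Letter (n + 3))}
    (hw : PathIn (ann lo hi lo' hi') p w) (hcl : disp w = 0) :
    ‖((hol V p w : 𝔸ˣ) : 𝔸) - 1‖ ≤ w.length * (6 * (W : ℝ) ^ 2 * ε) :=
  (norm_hol_closed_sub_one_le hlo hhi hP₂ hW hV hε hP hw hcl).trans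
    (mul_le_mul_of_nonneg_left (mul_le_mul_of_nonneg_right (quadratic_le_six_sq hd) hε) (Nat.cast_nonneg _))

/-- **THE RECTANGULAR WILSON LOOP IN A BOX COLLAR**: if the SITES of the four sides of the `R × T` rectangle based at `x` in the
`(κ, μ)`-plane lie in the collar (the spanned rectangle may cross `P₂` — (FF)'s situation `D ∩ H ≠ ∅`), `‖V(∂R) − 1‖ ≤ 2(R + T)·(5W² + dW)·ε`;
so (FF)'s floor `(|h − 1| − #(D∩coll)·a) ∕ #(D∩H)` for such a loop is `O(a)`: under (BOX) the collar forces no `a`-independent curvature. -/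
theorem norm_hol_rectWord_sub_one_le {x : Fin (n + 3) → ℤ} {κ μ : Fin (n + 3)} {R T : ℕ}
    (h₁ : ∀ s : ℕ, s ≤ R → x + (s : ℤ) • e κ ∈ ann lo hi lo' hi')
    (h₂ : ∀ t : ℕ, t ≤ T → x + (R : ℤ) • e κ + (t : ℤ) • e μ ∈ ann lo hi lo' hi')
    (h₃ : ∀ s : ℕ, s ≤ R → x + (s : ℤ) • e κ + (T : ℤ) • e μ ∈ ann lo hi lo' hi')
    (h₄ : ∀ t : ℕ, t ≤ T → x + (t : ℤ) • e μ ∈ ann lo hi lo' hi') :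
    ‖((hol V x (rectWord κ μ R T) : 𝔸ˣ) : 𝔸) - 1‖ ≤ 2 * (R + T) * ((5 * (W : ℝ) ^ 2 + (n + 3) * W) * ε) := by
  have h := norm_hol_closed_sub_one_le hlo hhi hP₂ hW hV hε hP (pathIn_rectWord h₁ h₂ h₃ h₄) (disp_rectWord κ μ R T)
  rw [length_rectWord] at h
  exact_mod_cast h

end BoxCollar

/-! ## §3 The carriers of the `Spine/NE7b` files: transfer along `ι : G →* 𝔸ˣ`, unit quaternions, `SU(N)` -/

section Transfer

variable {d : ℕ} {G H : Type*} [Group G] [Group H]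

/-- Parallel transport commutes with group homomorphisms: `hol (φ ∘ V) = φ (hol V)`. -/
theorem hol_map (φ : G →* H) (V : (Fin d → ℤ) → Fin d → G) :
    ∀ (p : Fin d → ℤ) (w : List (Letter d)), hol (fun x μ => φ (V x μ)) p w = φ (hol V p w)
  | p, [] => by simp
  | p, l :: w => by
    rw [hol_cons, hol_cons, map_mul, hol_map φ V _ w]
    congr 1
    obtain ⟨μ, b⟩ := l
    cases b <;> simp [stepHol]

variable {n : ℕ} {𝔸 : Type*} [NormedRing 𝔸] [NormOneClass 𝔸]

omit [NormOneClass 𝔸] in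
/-- The collar plaquette hypothesis transfers along a hom `ι : G →* 𝔸ˣ` whose size `‖ι g − 1‖` is a given function `s` on `G`. -/
theorem plaqSmallOn_map (ι : G →* 𝔸ˣ) (s : G → ℝ) (hs : ∀ g, ‖((ι g : 𝔸ˣ) : 𝔸) - 1‖ = s g) {A : Set (Fin d → ℤ)}
    {V : (Fin d → ℤ) → Fin d → G} {ε : ℝ}
    (h : ∀ (z : Fin d → ℤ) (κ μ : Fin d), κ ≠ μ → z ∈ A → z + e κ ∈ A → z + e μ ∈ A → z + e κ + e μ ∈ A →
      s (hol V z (plaqWord κ μ)) ≤ ε) :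
    PlaqSmallOn A (fun x μ => ι (V x μ)) ε := by
  intro z κ μ hκμ h1 h2 h3 h4
  rw [hol_map, hs]
  exact h z κ μ hκμ h1 h2 h3 h4

/-- **(TC-box), HOLONOMY FORM, FOR `G`-VALUED FIELDS** along a hom `ι : G →* 𝔸ˣ` into `U1 𝔸` with `‖ι g − 1‖ = s g`: on the box
collar, `s(V(∂p)) ≤ ε` on the collar plaquettes ⇒ `s(V(w)) ≤ |w|·(5W² + dW)·ε` for every closed collar walk. -/
theorem size_hol_closed_le_of_hom (ι : G →* 𝔸ˣ) (hι : ∀ g, ι g ∈ U1 𝔸) (s : G → ℝ)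
    (hs : ∀ g, ‖((ι g : 𝔸ˣ) : 𝔸) - 1‖ = s g) {lo hi lo' hi' : Fin (n + 3) → ℤ} (hlo : ∀ κ, lo κ < lo' κ)
    (hhi : ∀ κ, hi' κ < hi κ) (hP₂ : lo' ≤ hi') {W : ℕ} (hW : ∀ κ, hi κ - lo κ ≤ W)
    {V : (Fin (n + 3) → ℤ) → Fin (n + 3) → G} {ε : ℝ} (hε : 0 ≤ ε)
    (hP : ∀ (z : Fin (n + 3) → ℤ) (κ μ : Fin (n + 3)), κ ≠ μ → z ∈ ann lo hi lo' hi' → z + e κ ∈ ann lo hi lo' hi' →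
      z + e μ ∈ ann lo hi lo' hi' → z + e κ + e μ ∈ ann lo hi lo' hi' → s (hol V z (plaqWord κ μ)) ≤ ε)
    {p : Fin (n + 3) → ℤ} {w : List (Letter (n + 3))} (hw : PathIn (ann lo hi lo' hi') p w) (hcl : disp w = 0) :
    s (hol V p w) ≤ w.length * ((5 * (W : ℝ) ^ 2 + (n + 3) * W) * ε) := by
  rw [← hs, ← hol_map]
  exact norm_hol_closed_sub_one_le hlo hhi hP₂ hW (fun x κ => hι _) hε (plaqSmallOn_map ι s hs hP) hw hcl

end Transfer

section Sphere

open Quaternion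

/-- The unit quaternions sit in `U1 ℍ` (`‖q‖ = ‖q⁻¹‖ = 1`). -/
theorem unitSphereToUnits_mem_U1 (q : Metric.sphere (0 : ℍ) 1) : unitSphereToUnits ℍ q ∈ U1 ℍ := by
  rw [mem_U1, ← map_inv]
  simp only [unitSphereToUnits_apply_coe]
  exact ⟨(mem_sphere_zero_iff_norm.mp q.2).le, (mem_sphere_zero_iff_norm.mp (q⁻¹).2).le⟩

variable {n : ℕ} {lo hi lo' hi' : Fin (n + 3) → ℤ} (hlo : ∀ κ, lo κ < lo' κ) (hhi : ∀ κ, hi' κ < hi κ) (hP₂ : lo' ≤ hi')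
  {W : ℕ} (hW : ∀ κ, hi κ - lo κ ≤ W) (U : ZdGaugeConfig (n + 3) (Metric.sphere (0 : ℍ) 1)) {ε : ℝ} (hε : 0 ≤ ε)
  (hP : ∀ (z : Fin (n + 3) → ℤ) (κ μ : Fin (n + 3)), κ ≠ μ → z ∈ ann lo hi lo' hi' → z + e κ ∈ ann lo hi lo' hi' →
    z + e μ ∈ ann lo hi lo' hi' → z + e κ + e μ ∈ ann lo hi lo' hi' →
    ‖((ZdGaugeConfig.plaquette U z κ μ : Metric.sphere (0 : ℍ) 1) : ℍ) - 1‖ ≤ ε)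
include hlo hhi hP₂ hW hε hP

/-- **(TC-box), HOLONOMY FORM, ON `S³`-VALUED CONFIGURATIONS** (the carrier of the PH-k chain and of W-hol's (W4)): for
`U : ZdGaugeConfig (n+3) S³` on the box collar (`P₂` non-empty, strictly inside `P₁`, sides `≤ W + 1` sites), if every plaquette with
its corners in the collar has `‖U(∂p) − 1‖ ≤ ε`, every closed collar walk has `‖U(w) − 1‖ ≤ |w|·(5W² + dW)·ε`
(`‖q − 1‖` = `sphereGaugeGroup.dist1 q`). -/
theorem sphere_norm_hol_closed_sub_one_le {p : Fin (n + 3) → ℤ} {w : List (Letter (n + 3))}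
    (hw : PathIn (ann lo hi lo' hi') p w) (hcl : disp w = 0) :
    ‖((hol (curry U) p w : Metric.sphere (0 : ℍ) 1) : ℍ) - 1‖ ≤ w.length * ((5 * (W : ℝ) ^ 2 + (n + 3) * W) * ε) :=
  size_hol_closed_le_of_hom (unitSphereToUnits ℍ) unitSphereToUnits_mem_U1 (fun q => ‖(q : ℍ) - 1‖) (fun _ => rfl)
    hlo hhi hP₂ hW hε (fun z κ μ hκμ h1 h2 h3 h4 => by
      rw [← plaquette_eq_hol_plaqWord]; exact hP z κ μ hκμ h1 h2 h3 h4) hw hcl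

/-- **THE RECTANGULAR WILSON LOOP IN A BOX COLLAR, `S³` CARRIER**: if the sites of the four sides of the `R × T` rectangle based
at `x` in the `(i, j)`-plane lie in the collar, `‖U.rectangle x i j R T − 1‖ ≤ 2(R + T)·(5W² + dW)·ε` — to be read against
`NonAbelianStokesReading.sphere_forcedFlux_rectangle`: under (BOX) the forced-flux floor is `O(ε)`. -/
theorem sphere_norm_rectangle_sub_one_le {x : Fin (n + 3) → ℤ} {i j : Fin (n + 3)} {R T : ℕ}
    (h₁ : ∀ s : ℕ, s ≤ R → x + Pi.single i (s : ℤ) ∈ ann lo hi lo' hi')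
    (h₂ : ∀ t : ℕ, t ≤ T → x + Pi.single i (R : ℤ) + Pi.single j (t : ℤ) ∈ ann lo hi lo' hi')
    (h₃ : ∀ s : ℕ, s ≤ R → x + Pi.single i (s : ℤ) + Pi.single j (T : ℤ) ∈ ann lo hi lo' hi')
    (h₄ : ∀ t : ℕ, t ≤ T → x + Pi.single j (t : ℤ) ∈ ann lo hi lo' hi') :
    ‖((ZdGaugeConfig.rectangle U x i j R T : Metric.sphere (0 : ℍ) 1) : ℍ) - 1‖ ≤
      2 * (R + T) * ((5 * (W : ℝ) ^ 2 + (n + 3) * W) * ε) := by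
  have h := sphere_norm_hol_closed_sub_one_le hlo hhi hP₂ hW U hε hP
    (pathIn_rectWord (S := ann lo hi lo' hi') (x := x) (κ := i) (μ := j) (R := R) (T := T)
      (fun s hs => by rw [natCast_smul_e]; exact h₁ s hs)
      (fun t ht => by rw [natCast_smul_e, natCast_smul_e]; exact h₂ t ht)
      (fun s hs => by rw [natCast_smul_e, natCast_smul_e]; exact h₃ s hs)
      (fun t ht => by rw [natCast_smul_e]; exact h₄ t ht))
    (disp_rectWord i j R T)
  rw [length_rectWord, ← rectangle_eq_hol_rectWord] at h
  exact_mod_cast h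

end Sphere

section SpecialUnitary

open scoped Matrix.Norms.L2Operator
open Literature.MathematicalPhysics.QuantumLattice (fundamentalRep fundamentalRep_mem_unitaryGroup)
open Literature.MathematicalPhysics.QuantumFieldTheory.Balaban1983to89 (UnitaryModel.norm_of_mem_unitaryGroup)

variable {m : Type*} [Fintype m] [DecidableEq m] [Nonempty m]

/-- `SU(N) ⊂ M_N(ℂ)ˣ` lands in `U1` for the L²-operator norm (`‖U‖ = ‖U⁻¹‖ = 1`). -/
theorem toHomUnits_fundamentalRep_mem_U1 (U : Matrix.specialUnitaryGroup m ℂ) :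
    (fundamentalRep m).toHomUnits U ∈ U1 (Matrix m m ℂ) := by
  rw [mem_U1, ← map_inv, MonoidHom.coe_toHomUnits, MonoidHom.coe_toHomUnits]
  exact ⟨(UnitaryModel.norm_of_mem_unitaryGroup (fundamentalRep_mem_unitaryGroup U)).le,
    (UnitaryModel.norm_of_mem_unitaryGroup (fundamentalRep_mem_unitaryGroup U⁻¹)).le⟩

/-- The tree's `dist1` on `SU(N)` (`UnitaryModel.instGaugeGroupSpecialUnitaryGroup`) is the `U1` size `‖U − 1‖_{op}` along the inclusion. -/
theorem norm_toHomUnits_fundamentalRep_sub_one (U : Matrix.specialUnitaryGroup m ℂ) :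
    ‖(((fundamentalRep m).toHomUnits U : (Matrix m m ℂ)ˣ) : Matrix m m ℂ) - 1‖ = dist1 U := rfl

variable {n : ℕ} {lo hi lo' hi' : Fin (n + 3) → ℤ} (hlo : ∀ κ, lo κ < lo' κ) (hhi : ∀ κ, hi' κ < hi κ) (hP₂ : lo' ≤ hi')
  {W : ℕ} (hW : ∀ κ, hi κ - lo κ ≤ W) (U : ZdGaugeConfig (n + 3) (Matrix.specialUnitaryGroup m ℂ)) {ε : ℝ} (hε : 0 ≤ ε)
  (hP : ∀ (z : Fin (n + 3) → ℤ) (κ μ : Fin (n + 3)), κ ≠ μ → z ∈ ann lo hi lo' hi' → z + e κ ∈ ann lo hi lo' hi' →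
    z + e μ ∈ ann lo hi lo' hi' → z + e κ + e μ ∈ ann lo hi lo' hi' → dist1 (ZdGaugeConfig.plaquette U z κ μ) ≤ ε)
include hlo hhi hP₂ hW hε hP

/-- **(TC-box), HOLONOMY FORM, ON `SU(N)`-VALUED CONFIGURATIONS** (the cell's `GaugeGroup` instance, `dist1 = ‖· − 1‖_{op}`): for
`U : ZdGaugeConfig (n+3) SU(N)` on the box collar (`P₂` non-empty, strictly inside `P₁`, sides `≤ W + 1` sites), if every plaquette
with its corners in the collar has `dist1 U(∂p) ≤ ε`, every closed collar walk has `dist1 U(w) ≤ |w|·(5W² + dW)·ε`. -/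
theorem su_dist1_hol_closed_le {p : Fin (n + 3) → ℤ} {w : List (Letter (n + 3))} (hw : PathIn (ann lo hi lo' hi') p w)
    (hcl : disp w = 0) : dist1 (hol (curry U) p w) ≤ w.length * ((5 * (W : ℝ) ^ 2 + (n + 3) * W) * ε) :=
  size_hol_closed_le_of_hom ((fundamentalRep m).toHomUnits) toHomUnits_fundamentalRep_mem_U1 dist1
    norm_toHomUnits_fundamentalRep_sub_one hlo hhi hP₂ hW hε (fun z κ μ hκμ h1 h2 h3 h4 => by
      rw [← plaquette_eq_hol_plaqWord]; exact hP z κ μ hκμ h1 h2 h3 h4) hw hcl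

/-- **THE RECTANGULAR WILSON LOOP IN A BOX COLLAR, `SU(N)` CARRIER**: if the sites of the four sides of the `R × T` rectangle based
at `x` in the `(i, j)`-plane lie in the collar, `dist1 (U.rectangle x i j R T) ≤ 2(R + T)·(5W² + dW)·ε` — to be read against
`NonAbelianStokesReading.forcedFlux_rectangle`: under (BOX) the forced-flux floor is `O(ε)`. -/
theorem su_dist1_rectangle_le {x : Fin (n + 3) → ℤ} {i j : Fin (n + 3)} {R T : ℕ}
    (h₁ : ∀ s : ℕ, s ≤ R → x + Pi.single i (s : ℤ) ∈ ann lo hi lo' hi')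
    (h₂ : ∀ t : ℕ, t ≤ T → x + Pi.single i (R : ℤ) + Pi.single j (t : ℤ) ∈ ann lo hi lo' hi')
    (h₃ : ∀ s : ℕ, s ≤ R → x + Pi.single i (s : ℤ) + Pi.single j (T : ℤ) ∈ ann lo hi lo' hi')
    (h₄ : ∀ t : ℕ, t ≤ T → x + Pi.single j (t : ℤ) ∈ ann lo hi lo' hi') :
    dist1 (ZdGaugeConfig.rectangle U x i j R T) ≤ 2 * (R + T) * ((5 * (W : ℝ) ^ 2 + (n + 3) * W) * ε) := by
  have h := su_dist1_hol_closed_le hlo hhi hP₂ hW U hε hP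
    (pathIn_rectWord (S := ann lo hi lo' hi') (x := x) (κ := i) (μ := j) (R := R) (T := T)
      (fun s hs => by rw [natCast_smul_e]; exact h₁ s hs)
      (fun t ht => by rw [natCast_smul_e, natCast_smul_e]; exact h₂ t ht)
      (fun s hs => by rw [natCast_smul_e, natCast_smul_e]; exact h₃ s hs)
      (fun t ht => by rw [natCast_smul_e]; exact h₄ t ht))
    (disp_rectWord i j R T)
  rw [length_rectWord, ← rectangle_eq_hol_rectWord] at h
  exact_mod_cast h

end SpecialUnitary

end

end Summit.QuantumFields.BalabanUV.T4Continuum.NE7b.BoxCollarHolonomy
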